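import Literature.MathematicalPhysics.QuantumFieldTheory.Balaban1983to89.B15Claim189HypothesesOfRecord

/-!
# `Balaban1983to89.B15Claim189PinStackOfRecord` — YM-DAG node N12 · [Balaban1989LargeFieldI] CMP **122** (1989) 175–202, (1.89) p. 198 with (1.10)–(1.12) p. 179, (1.73) p. 192,
# (1.80) p. 195, (1.88) p. 198, p. 178, p. 195: THE WHOLE PIN STACK OF THE (1.89) SITUATION AS ONE TRANSFORMER — `Sit189.pinPre` (the four letter pins of this seat's generation 7:
# `Zres`, cube sides, `χ_k(Ω_k^{∼4})` family, `Ω″`) and `Sit189.pinStackOfRecord` (then `Λ`, distance, `Z″`, cubes over the enlargement of record) — with the (1.89) display, the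
# `Z″`-structure from record inputs and dag-n12-d's λ-layer STATED AT ONE NAME

statement-level bookkeeping over published theorems with citation tags; kernel-checked compositions of tree theorems; nothing here is a claim about the Yang–Mills
mass gap.

CITATION HEADER (lean-in-tree rule).  Source: [Balaban1989LargeFieldI] («[IV]»), the displays each pin reads (quoted verbatim in modules 13–20): (1.10)–(1.12) p. 179 (the
regions `Z″_j`, `Ω″_j`), (1.73) p. 192 (`Λ`), (1.80) p. 195 (`dist(p, Λ)`), p. 195 (`Ω″_{h+1} = Ω^{∼5}_{h+1}`, `Ω″^{∼2}_{h+1} = Ω^{∼7}_{h+1}`), p. 178 (the `LM₂R_j`-cubes of (1.3)), (1.88)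
p. 198 (the cubes of `χ_{h,1/2}`), (1.89) p. 198 (the display), (1.2) p. 178 (`χ_k(Ω_k^{∼4})`); [Balaban1988Convergent] («[III]») (2.1) p. 254, (2.13) p. 256, (2.16)–(2.17) p. 257.
Seat `pub-ymgap-dag-n12-e` (YM-PLAN Track A, HUMAN RULING D-0062; director-ym R134 row N12 s3), generation 7, module 21.  BY NAME and UNCHANGED: modules 13 (`Sit189.pinZpp`), 14
(`D189OfHist`, `sitOfHist`), 15 (`Sit189.pinCubes ∕ pinDistAt`), 16 (`enlD`, `Sit189.pinLambda`, `ResidW.pinD189ΛH`), 17 (`Sit189.pinSides ∕ pinOmegaPP`), 18 (`Sit189.pinXΩ4`), 19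
(`Sit189.pinZres`, `omegaT`, `zppOfRecordT`, `claim189_sitOfHist_ΛΩχZ_of_flow`, `claim189_sitOfHist₁₃_ΛΩχZ_of_inInterval`), 20 (`Zpp_stack_structure_of_record`), module 11
(`omegaOfChain`), module 12∕14 (`N0OfSeq`, `N0OfRecord₁₃`), p29's `B15Claim189Assembly` letters and `B15Eq112Admissible.Admissible`, r12's `B15DeterminingSets.omegaPP`.

WHY THIS FILE.  After modules 13–20 the (1.89) situation of a term is pinned by an EIGHT-DEEP stack of transformers, spelled out in full in every display theorem and in dag-n12-d's
`σT` instantiations.  This file gives the stack ONE NAME — `σ.pinPre ν M g s N₀ N enl` for the four pins that must precede module 16's λ-layer (`Zres`, sides, `χ_k(Ω_k^{∼4})` family,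
`Ω″`), and `σ.pinStackOfRecord ν M g s N₀ N` for the whole stack over the enlargement of record (then `Λ`, distance, `Z″`, cubes over the half domain) — both `rfl`-equal to the
spelled-out stacks, and restates at that name: the (1.89) display (module 19 §4), the `Z″`-structure from record inputs (module 20 §3), and the fact that dag-n12-d's λ-layer
`ResidW.pinD189ΛH` at `σT := (σ ·).pinPre …` IS the letters of `pinStackOfRecord` (`rfl`).  Nothing new is claimed; the file is the index of the lineage's pins.

* §1 **`Node00.Sit189.pinPre`** (+ `pinPre_eq`, faces), **`Node00.Sit189.pinStackOfRecord`** (+ `pinStackOfRecord_eq`, faces).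
* §2 ★★★ `claim189_pinStackOfRecord_of_flow`, `claim189_pinStackOfRecord₁₃_of_inInterval` (module 19's display at the named stack).
* §3 ★★ `Zpp_pinStackOfRecord_eq_zppOfRecordT` (module 19's identification at the name), ★★ `Zpp_pinStackOfRecord_structure_of_record` (module 20's structure theorem at the named stack).
* §4 `pinD189ΛH_pinPre_D189` (dag-n12-d's λ-layer over pre-pinned situations reads the named stack, `rfl`).

RESIDUAL after the stack (for the record): the component union `Z` (term data), the `χ_h(Ω_h∩Z_h)` family `XH` (inert for `B15Leaf`), the numbers `β, L₀, δ, B₃, B₅, O(1)`, the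
deviation letters `devV″, dev97`, the exponent `p₁`; displayed inputs as in module 19 §4.

HONEST FRAMING.  Count-neutral: two abbreviating transformers and restatements by `rfl`; NO estimate of Bałaban's asserted; N12 NOT discharged; one finite four-torus programme at
fixed `ε`, Bałaban AS PRINTED with locators; nothing continuum ∕ ℝ⁴ ∕ OS ∕ mass gap ∕ Clay.  No `sorry`, no `axiom`, no `instance`, no `notation`.
-/

noncomputable section

namespace Literature.MathematicalPhysics.QuantumFieldTheory.Balaban1983to89

namespace B15Claim189PinStackOfRecord

open DagBinding T4Continuum Node00
open B14DomainGeom (Pt)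
open B14.Eq213MaximalDomains (side)
open B15Claim189PrintedConditions (omegaOfChain)
open B15Claim189LambdaPin (enlD)
open B15Claim189ZppOfRecordPin (zppOfRecordT omegaT)
open B15Claim189N0OfRecord (N0OfSeq)
open B15Eq112TorusCover (cover pullSeq)

/-! ## §1. The named stacks -/

section Defs

variable {F : T4Family} {N : ℕ} [NeZero N]

/-- **THE FOUR PRE-PINS OF GENERATION 7 AS ONE TRANSFORMER**: `σ.pinPre ν M g s N₀ N enl := (((σ.pinZres ν M g s N₀).pinSides ν g (k′−N) k′).pinXΩ4 s enl).pinOmegaPP s N enl` — the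
interpolated `Z″_j` of record (module 19), the `LM₂R`-cube sides (module 17), the `χ_k(Ω_k^{∼4})` cube family (module 18) and `Ω″^∼_{h+1} ∕ Ω″^{∼2}_{h+1}` (module 17); these are the pins
that must precede module 16's λ-layer `pinD189ΛH` (which applies `Λ`, distance, `Z″`, cubes and `sitOfHist`).  Data, no law.
[cite: Balaban1989LargeFieldI, (1.10)–(1.11) p.179, p.178, (1.2) p.178, p.195, (1.89) p.198] -/
def _root_.Literature.MathematicalPhysics.QuantumFieldTheory.Balaban1983to89.Node00.Sit189.pinPre {P : B12.RunParams} (σ : Sit189 F N P.K) (ν : Stage7Numerics) (M : ℕ) (g : ℕ → ℝ)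
    {k' : ℕ} (s : SeqOfRecord F ν M g P.K k') (N₀ Nm : ℕ) (enl : ℕ → ℕ → Set (Site (F.P P.K) 0) → Set (Site (F.P P.K) 0)) : Sit189 F N P.K :=
  (((σ.pinZres ν M g s N₀).pinSides ν g (k' - Nm) k').pinXΩ4 s enl).pinOmegaPP s Nm enl

/-- **THE WHOLE PIN STACK OVER THE ENLARGEMENT OF RECORD** (below module 14's `sitOfHist`): `pinPre` over `enlD`, then module 16's `Λ`, module 15's distance at `k′`, module 13's `Z″`,
module 15's cubes over the half domain `(Ω″^∼_{h+1})ᶜ ∩ Ω_h`.  Data, no law. [cite: Balaban1989LargeFieldI, (1.89) p.198, (1.73) p.192, (1.80) p.195, (1.88) p.198, (1.10)–(1.11) p.179] -/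
def _root_.Literature.MathematicalPhysics.QuantumFieldTheory.Balaban1983to89.Node00.Sit189.pinStackOfRecord {P : B12.RunParams} (σ : Sit189 F N P.K) (ν : Stage7Numerics) (M : ℕ)
    (g : ℕ → ℝ) {k' : ℕ} (s : SeqOfRecord F ν M g P.K k') (N₀ Nm : ℕ) : Sit189 F N P.K :=
  ((((σ.pinPre ν M g s N₀ Nm (enlD F ν M P g)).pinLambda s N₀ (enlD F ν M P g)).pinDistAt k').pinZpp s N₀ Nm (enlD F ν M P g)).pinCubes
    (((((σ.pinPre ν M g s N₀ Nm (enlD F ν M P g)).pinLambda s N₀ (enlD F ν M P g)).pinDistAt k').pinZpp s N₀ Nm (enlD F ν M P g)).OmTᶜ ∩ omegaOfChain s (k' - Nm))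

variable {P : B12.RunParams} (σ : Sit189 F N P.K) (ν : Stage7Numerics) (M : ℕ) (g : ℕ → ℝ) {k' : ℕ} (s : SeqOfRecord F ν M g P.K k') (N₀ Nm : ℕ)
  (enl : ℕ → ℕ → Set (Site (F.P P.K) 0) → Set (Site (F.P P.K) 0))

/-- Unfolding (`rfl`). [cite: Balaban1989LargeFieldI, (1.89) p.198 (bookkeeping)] -/
theorem pinPre_eq : σ.pinPre ν M g s N₀ Nm enl = (((σ.pinZres ν M g s N₀).pinSides ν g (k' - Nm) k').pinXΩ4 s enl).pinOmegaPP s Nm enl := rfl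

/-- Unfolding (`rfl`). [cite: Balaban1989LargeFieldI, (1.89) p.198 (bookkeeping)] -/
theorem pinStackOfRecord_eq : σ.pinStackOfRecord ν M g s N₀ Nm =
    ((((σ.pinPre ν M g s N₀ Nm (enlD F ν M P g)).pinLambda s N₀ (enlD F ν M P g)).pinDistAt k').pinZpp s N₀ Nm (enlD F ν M P g)).pinCubes
      (((((σ.pinPre ν M g s N₀ Nm (enlD F ν M P g)).pinLambda s N₀ (enlD F ν M P g)).pinDistAt k').pinZpp s N₀ Nm (enlD F ν M P g)).OmTᶜ ∩ omegaOfChain s (k' - Nm)) := rfl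

/-- The pre-pinned letters (`rfl` ×5): `Zpp` = the torus regions of record (as module 13's interpolating family), `sh ∕ sk` = def-R's `LM₂R_h ∕ LM₂R_{k′}` sides, `OmT ∕ ΩppT2` = `Ω^{∼6}_{h+1} ∕
Ω^{∼7}_{h+1}`; the other letters of `σ` are kept. [cite: Balaban1989LargeFieldI, (1.10)–(1.11) p.179, p.178, p.195 (bookkeeping)] -/
theorem pinPre_letters : (σ.pinPre ν M g s N₀ Nm enl).Zpp = zppOfRecordT F ν M P g s N₀ σ.Z ∧
    (σ.pinPre ν M g s N₀ Nm enl).sh = cubeSide (F.P P.K).L ν.M₂ (RkOfRecord (F.P P.K).L ν.r (g (k' - Nm))) (k' - Nm) ∧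
    (σ.pinPre ν M g s N₀ Nm enl).sk = cubeSide (F.P P.K).L ν.M₂ (RkOfRecord (F.P P.K).L ν.r (g k')) k' ∧
    (σ.pinPre ν M g s N₀ Nm enl).OmT = enl 6 (k' - Nm + 1) (omegaOfChain s (k' - Nm + 1)) ∧ (σ.pinPre ν M g s N₀ Nm enl).ΩppT2 = enl 7 (k' - Nm + 1) (omegaOfChain s (k' - Nm + 1)) ∧
    (σ.pinPre ν M g s N₀ Nm enl).Z = σ.Z ∧ (σ.pinPre ν M g s N₀ Nm enl).Λ = σ.Λ ∧ (σ.pinPre ν M g s N₀ Nm enl).Ω = σ.Ω ∧ (σ.pinPre ν M g s N₀ Nm enl).β = σ.β ∧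
    (σ.pinPre ν M g s N₀ Nm enl).L₀ = σ.L₀ ∧ (σ.pinPre ν M g s N₀ Nm enl).δ = σ.δ ∧ (σ.pinPre ν M g s N₀ Nm enl).B₃ = σ.B₃ ∧ (σ.pinPre ν M g s N₀ Nm enl).B₅ = σ.B₅ ∧
    (σ.pinPre ν M g s N₀ Nm enl).O1 = σ.O1 ∧ (σ.pinPre ν M g s N₀ Nm enl).devV'' = σ.devV'' ∧ (σ.pinPre ν M g s N₀ Nm enl).dev97 = σ.dev97 :=
  ⟨rfl, rfl, rfl, rfl, rfl, rfl, rfl, rfl, rfl, rfl, rfl, rfl, rfl, rfl, rfl, rfl⟩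

/-- The fully stacked situation carries the pinned `Ω″`-letters, `Λ` of (1.73) over the enlargement of record and def-R's `LM₂R_{k′}`-side (`rfl` ×4; the kept residual letters —
`Z`, `β, L₀, δ, B₃, B₅, O(1)`, `devV″, dev97` — are read through the component pins' `_kept` lemmas). [cite: Balaban1989LargeFieldI, (1.73) p.192, p.195, p.178 (bookkeeping)] -/
theorem pinStackOfRecord_letters :
    (σ.pinStackOfRecord ν M g s N₀ Nm).OmT = enlD F ν M P g 6 (k' - Nm + 1) (omegaOfChain s (k' - Nm + 1)) ∧
    (σ.pinStackOfRecord ν M g s N₀ Nm).ΩppT2 = enlD F ν M P g 7 (k' - Nm + 1) (omegaOfChain s (k' - Nm + 1)) ∧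
    (σ.pinStackOfRecord ν M g s N₀ Nm).Λ = (enlD F ν M P g 4 (k' + 1 - N₀) (omegaOfChain s (k' + 1 - N₀)))ᶜ ∩ σ.Z ∧
    (σ.pinStackOfRecord ν M g s N₀ Nm).sk = cubeSide (F.P P.K).L ν.M₂ (RkOfRecord (F.P P.K).L ν.r (g k')) k' :=
  ⟨rfl, rfl, rfl, rfl⟩

end Defs

/-! ## §2. THE (1.89) DISPLAY AT THE NAMED STACK (module 19 §4 by `rfl`) -/

section Display

open B15 (Ineq180)
open B15.BasicStep (Claim189)
open B15.PrelimIntegrations (Ineq191 Ineq195)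
open B15Chi124DetSets (E124)
open B15DeterminingSets (MSField)
open B15Claim189Assembly (Setting189 new189 chiPP dom half)
open B15Claim189PinsOfHistory (D189OfHist sitOfHist N0OfRecord₁₃)
open B15Claim189ZppOfRecordPin (claim189_sitOfHist_ΛΩχZ_of_flow claim189_sitOfHist₁₃_ΛΩχZ_of_inInterval)
open B8Eq17ClassAkV1 (plaqsOf)
open GaugeGroup (dist1)
open GaugeField (plaqHol)
open FlowStep (HBeta prefixOf BetaUpperH)
open FlowStepRuns (genSeq)
open B14FlowStep (SmallnessFor)

variable {F : T4Family} {N : ℕ} [NeZero N] {ν : Stage7Numerics} {A₁ : ℝ} {M : ℕ} (Nm : ℕ) (P : B12.RunParams) (σ : Sit189 F N P.K) {g : ℕ → ℝ} {k' : ℕ}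
  (s : SeqOfRecord F ν M g P.K k') (p₁ : ℕ)

/-- ★★★ **(1.89) AT THE NAMED STACK OF RECORD** — module 19's `claim189_sitOfHist_ΛΩχZ_of_flow` for `D = D189OfHist ν P (sitOfHist ν A₁ M N P (σ.pinStackOfRecord ν M g s N₀ N) g s N₀ p₁) g`,
`N₀ := N0OfSeq L r g k′` (`rfl` re-spelling).  EVERY region letter except `Z` is an object of record; displayed inputs: `1 < (log g_{k′}⁻²)^r`, `N₀ ≤ N ≤ ·`, `N₀ ≤ k′`, residual numerics ∕
signs, `0 < M₂`, `0 < M`, print's two p. 200 conditions, the flow inputs, one step of monotone couplings, `Λ ≠ ∅`, the four ℍ-leaves and (1.80).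
[cite: Balaban1989LargeFieldI, (1.89) p.198, pp.199–200, (1.80) p.195; Balaban1988Convergent, (2.1) p.254, (2.5)–(2.8) pp.255–256, (2.17) p.257] -/
theorem claim189_pinStackOfRecord_of_flow (hM₂ : 0 < ν.M₂) (hM : 0 < M)
    {D : Setting189 (F.P P.K) (SU N) (MSField (F.P P.K) (SU N) × ((j : ℕ) → VecField (F.P P.K) j (EuclideanSpace ℝ (Fin (N ^ 2 - 1))))) (Pt (F.P P.K).d)}
    (hD : D = D189OfHist ν P (sitOfHist ν A₁ M Nm P (σ.pinStackOfRecord ν M g s (N0OfSeq (F.P P.K).L ν.r g k') Nm) g s (N0OfSeq (F.P P.K).L ν.r g k') p₁) g)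
    (hlog : 1 < (Real.log (g k' ^ 2)⁻¹) ^ ν.r) (hNN : N0OfSeq (F.P P.K).L ν.r g k' ≤ Nm) (hNk : N0OfSeq (F.P P.K).L ν.r g k' ≤ k')
    (hβ0 : 0 ≤ σ.β) (hβ : σ.β ≤ 1 / 4) (hL₀ : 2 ≤ σ.L₀) (hL₀L : σ.L₀ ^ 2 ≤ ((F.P P.K).L : ℝ))
    (hB : 0 ≤ σ.O1 * σ.B₃ * σ.B₅) (hδ : 0 ≤ σ.δ)
    (hN₀ : (2 + (121 / 120) ^ 2 * (σ.O1 * σ.B₃ * σ.B₅ * (M : ℝ) ^ 5)) * ((σ.L₀ ^ 2) ^ (N0OfSeq (F.P P.K).L ν.r g k' - 1))⁻¹ ≤ 1 / 4)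
    (hMl : (121 / 120) ^ 2 * (σ.O1 * σ.B₃ * σ.B₅ * (M : ℝ) ^ 5) * Real.exp (-(4 * σ.δ * (M : ℝ))) ≤ 1 / 12)
    (hε0 : ∀ i, k' - Nm ≤ i → i ≤ k' → 0 ≤ epsOfRecord ν g i) (hε1 : ∀ i, k' - Nm ≤ i → i ≤ k' → epsOfRecord ν g i ≤ 1 / 10)
    {β₀ : ℝ} (hβ₀0 : 0 ≤ β₀) (hβ₀ : β₀ ≤ 1 / 2)
    (hflow : ∀ j, k' - Nm ≤ j → j < k' → epsOfRecord ν g k' ≤ (1 + β₀) * Real.sqrt ((k' - j : ℕ) : ℝ) * epsOfRecord ν g j)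
    (hgpos : 0 < g (k' + 1 - N0OfSeq (F.P P.K).L ν.r g k')) (hgstep : g (k' + 1 - N0OfSeq (F.P P.K).L ν.r g k') ≤ g (k' + 2 - N0OfSeq (F.P P.K).L ν.r g k'))
    (hgle : g (k' + 2 - N0OfSeq (F.P P.K).L ν.r g k') ≤ 1)
    (hΛ : ((enlD F ν M P g 4 (k' + 1 - N0OfSeq (F.P P.K).L ν.r g k') (omegaOfChain s (k' + 1 - N0OfSeq (F.P P.K).L ν.r g k')))ᶜ ∩ σ.Z).Nonempty)
    (L91h : ∀ U, new189 D U → ∀ p ∈ plaqsOf (half D),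
      Ineq191 (dist1 (plaqHol (D.Upp U) p)) (D.devV'' U p) D.α ((D.L ^ D.h)⁻¹) (D.ε D.h) (E124 D.ε D.L D.η D.k D.h))
    (L95 : ∀ U, new189 D U → ∀ p ∈ plaqsOf (half D),
      Ineq195 (D.devV'' U p) (dist1 (plaqHol (D.Uhalf U (D.boxOf p)) p)) D.α ((D.L ^ D.h)⁻¹) (D.ε D.h) (E124 D.ε D.L D.η D.k D.h))
    (L91 : ∀ U, new189 D U → ∀ j, D.h ≤ j → j ≤ D.k → ∀ p ∈ plaqsOf (dom D j),
      Ineq191 (dist1 (plaqHol (D.Upp U) p)) (D.dev97 U p) D.α ((D.L ^ j)⁻¹) (D.ε j) (E124 D.ε D.L D.η D.k j))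
    (L97 : ∀ U, new189 D U → ∀ j, D.h ≤ j → j ≤ D.k → ∀ p ∈ plaqsOf (dom D j),
      Ineq191 (D.dev97 U p) (D.dev0 U p) D.α ((D.L ^ j)⁻¹) (D.ε j) (E124 D.ε D.L D.η D.k j))
    (L80 : ∀ U, new189 D U → ∀ j, D.h ≤ j → j ≤ D.k → ∀ p ∈ plaqsOf (dom D j),
      Ineq180 (D.dev0 U p) (D.ε D.k) D.η D.B₃ D.B₅ D.M D.δ (D.dist p) D.O1) :
    Claim189 (new189 D) (chiPP D) :=
  claim189_sitOfHist_ΛΩχZ_of_flow Nm P σ s p₁ hM₂ hM hD hlog hNN hNk hβ0 hβ hL₀ hL₀L hB hδ hN₀ hMl hε0 hε1 hβ₀0 hβ₀ hflow hgpos hgstep hgle hΛ L91h L95 L91 L97 L80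

variable {θ : Stage13Params F N} (s₁₃ : SeqOfRecord F θ.ν θ.τ9.M (gOfRecord₁₃ F N θ P) P.K k')

/-- ★★★ **THE SAME AT RECORD 13, IN THE RUN'S (2.7)-SMALL WINDOW** — module 19's `claim189_sitOfHist₁₃_ΛΩχZ_of_inInterval` for `σ.pinStackOfRecord θ.ν θ.τ9.M (gOfRecord₁₃ θ P) s N₀ N`,
`N₀ := N0OfRecord₁₃ θ P k′` (`rfl` re-spelling). [cite: Balaban1989LargeFieldI, (1.89) p.198, pp.199–200; Balaban1988Convergent, (2.1) p.254, (2.4)–(2.8) pp.255–256; Balaban1987RG1, (0.20) p.256, §1 p.264] -/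
theorem claim189_pinStackOfRecord₁₃_of_inInterval (hM₂ : 0 < θ.ν.M₂) (hM : 0 < θ.τ9.M)
    {D : Setting189 (F.P P.K) (SU N) (MSField (F.P P.K) (SU N) × ((j : ℕ) → VecField (F.P P.K) j (EuclideanSpace ℝ (Fin (N ^ 2 - 1))))) (Pt (F.P P.K).d)}
    (hD : D = D189OfHist θ.ν P (sitOfHist θ.ν θ.A₁ θ.τ9.M Nm P (σ.pinStackOfRecord θ.ν θ.τ9.M (gOfRecord₁₃ F N θ P) s₁₃ (N0OfRecord₁₃ θ P k') Nm)
      (gOfRecord₁₃ F N θ P) s₁₃ (N0OfRecord₁₃ θ P k') p₁) (gOfRecord₁₃ F N θ P))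
    (hr : 1 ≤ θ.ν.r) (hNN : (N0OfRecord₁₃ θ P k') ≤ Nm) (hNk : (N0OfRecord₁₃ θ P k') ≤ k')
    (hβ0 : 0 ≤ σ.β) (hβ : σ.β ≤ 1 / 4) (hL₀ : 2 ≤ σ.L₀) (hL₀L : σ.L₀ ^ 2 ≤ ((F.P P.K).L : ℝ))
    (hB : 0 ≤ σ.O1 * σ.B₃ * σ.B₅) (hδ : 0 ≤ σ.δ)
    (hwin : 4 * (2 + (121 / 120) ^ 2 * (σ.O1 * σ.B₃ * σ.B₅ * (θ.τ9.M : ℝ) ^ 5))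
      ≤ ((Real.log ((gOfRecord₁₃ F N θ P) k' ^ 2)⁻¹) ^ θ.ν.r) ^ (Real.log (σ.L₀ ^ 2) / Real.log ((F.P P.K).L : ℝ)))
    (hβhist : ∀ j, j < k' → 0 ≤ betaOfRecord₁₃ F N θ j (prefixOf (gOfRecord₁₃ F N θ P) j))
    (hMl : (121 / 120) ^ 2 * (σ.O1 * σ.B₃ * σ.B₅ * (θ.τ9.M : ℝ) ^ 5) * Real.exp (-(4 * σ.δ * (θ.τ9.M : ℝ))) ≤ 1 / 12)
    (hA₀ : 0 ≤ θ.ν.A₀) {β' β₀ : ℝ} {L : ℕ} (S : SmallnessFor θ.γ β' β₀ L θ.ν.p₀) (hβ₀ : β₀ ≤ 1 / 2) (hε10 : θ.γ * p0Profile θ.ν.A₀ θ.ν.p₀ θ.γ ≤ 1 / 10)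
    (hI : Step.InInterval θ.γ k' (gOfRecord₁₃ F N θ P)) (hup : BetaUpperH β' θ.γ (betaOfRecord₁₃ F N θ))
    (hΛ : (((enlD F θ.ν θ.τ9.M P (gOfRecord₁₃ F N θ P)) 4 (k' + 1 - (N0OfRecord₁₃ θ P k')) (omegaOfChain s₁₃ (k' + 1 - (N0OfRecord₁₃ θ P k'))))ᶜ ∩ σ.Z).Nonempty)
    (L91h : ∀ U, new189 D U → ∀ p ∈ plaqsOf (half D),
      Ineq191 (dist1 (plaqHol (D.Upp U) p)) (D.devV'' U p) D.α ((D.L ^ D.h)⁻¹) (D.ε D.h) (E124 D.ε D.L D.η D.k D.h))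
    (L95 : ∀ U, new189 D U → ∀ p ∈ plaqsOf (half D),
      Ineq195 (D.devV'' U p) (dist1 (plaqHol (D.Uhalf U (D.boxOf p)) p)) D.α ((D.L ^ D.h)⁻¹) (D.ε D.h) (E124 D.ε D.L D.η D.k D.h))
    (L91 : ∀ U, new189 D U → ∀ j, D.h ≤ j → j ≤ D.k → ∀ p ∈ plaqsOf (dom D j),
      Ineq191 (dist1 (plaqHol (D.Upp U) p)) (D.dev97 U p) D.α ((D.L ^ j)⁻¹) (D.ε j) (E124 D.ε D.L D.η D.k j))
    (L97 : ∀ U, new189 D U → ∀ j, D.h ≤ j → j ≤ D.k → ∀ p ∈ plaqsOf (dom D j),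
      Ineq191 (D.dev97 U p) (D.dev0 U p) D.α ((D.L ^ j)⁻¹) (D.ε j) (E124 D.ε D.L D.η D.k j))
    (L80 : ∀ U, new189 D U → ∀ j, D.h ≤ j → j ≤ D.k → ∀ p ∈ plaqsOf (dom D j),
      Ineq180 (D.dev0 U p) (D.ε D.k) D.η D.B₃ D.B₅ D.M D.δ (D.dist p) D.O1) :
    Claim189 (new189 D) (chiPP D) :=
  claim189_sitOfHist₁₃_ΛΩχZ_of_inInterval Nm P σ p₁ s₁₃ hM₂ hM hD hr hNN hNk hβ0 hβ hL₀ hL₀L hB hδ hwin hβhist hMl hA₀ S hβ₀ hε10 hI hup hΛ L91h L95 L91 L97 L80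

end Display

/-! ## §3. THE `Z″`-STRUCTURE AT THE NAMED STACK FROM RECORD INPUTS (module 20 §3 by `rfl`) -/

section Structure

open B15Claim189Assembly (Setting189)
open B15Claim189PinsOfHistory (D189OfHist sitOfHist)
open B15Claim189HypothesesOfRecord (Zpp_stack_structure_of_record)
open B15Claim189ZppOfRecordPin (Zpp_stack_eq_zppOfRecordT)
open B15DeterminingSets (MSField)
open B15Eq112Admissible (Admissible)

variable {F : T4Family} {N : ℕ} [NeZero N] {ν : Stage7Numerics} {A₁ : ℝ} {M : ℕ} (Nm : ℕ) (P : B12.RunParams) (σ : Sit189 F N P.K) {g : ℕ → ℝ} {k' : ℕ}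
  (s : SeqOfRecord F ν M g P.K k') (N₀ p₁ : ℕ)


/-- ★★ **AT THE NAMED STACK THE SITUATION's `Z″_j`, `j > h`, ARE THE TORUS REGIONS OF RECORD** (module 19's `Zpp_stack_eq_zppOfRecordT`, `rfl` re-spelling): inputs `0 < M`, `2 ≤ N₀ ≤ N`,
`N₀ ≤ k′`, the cube sides dividing the period, the `N₀`-equation. [cite: Balaban1989LargeFieldI, (1.10)–(1.11) p.179] -/
theorem Zpp_pinStackOfRecord_eq_zppOfRecordT
    {D : Setting189 (F.P P.K) (SU N) (MSField (F.P P.K) (SU N) × ((j : ℕ) → VecField (F.P P.K) j (EuclideanSpace ℝ (Fin (N ^ 2 - 1))))) (Pt (F.P P.K).d)}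
    (hD : D = D189OfHist ν P (sitOfHist ν A₁ M Nm P (σ.pinStackOfRecord ν M g s N₀ Nm) g s N₀ p₁) g)
    (hM : 0 < M) (hN2 : 2 ≤ N₀) (hNm : N₀ ≤ Nm) (hNk : N₀ ≤ k')
    (hdk : side (F.P P.K).L M k' ∣ (F.P P.K).sitesPerDir 0)
    (hdj : ∀ j, k' - Nm < j → j ≤ k' - N₀ → dCubeSide (F.P P.K).L M (RkOfRecord (F.P P.K).L ν.r (g j)) j ∣ (F.P P.K).sitesPerDir 0)
    (hN₀eq : dCubeSide (F.P P.K).L M (RkOfRecord (F.P P.K).L ν.r (g (k' + 1 - N₀))) (k' + 1 - N₀) = side (F.P P.K).L M k')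
    {j : ℕ} (hj : k' - Nm < j) : D.Zpp j = zppOfRecordT F ν M P g s N₀ σ.Z j :=
  Zpp_stack_eq_zppOfRecordT Nm P σ s N₀ p₁ k' (k' - Nm) _ (enlD F ν M P g) (enlD F ν M P g) (enlD F ν M P g) hD hM hN2 hNm hNk hdk hdj hN₀eq hj

/-- ★★ **THE (1.89) SITUATION's `Z″`-STRUCTURE AT THE NAMED STACK, FROM RECORD INPUTS** (module 20's `Zpp_stack_structure_of_record`, `rfl` re-spelling): above `h = k′ − N` the situation's
`Z″_j` are NESTED, DISJOINT FROM `Ω_j` (`j ≤ k′`), `Z ∖ Z″_{h+1} ⊆ Ω_h` (`Ω₀ = T_η`), and the (1.12) domains built from them are ADMISSIBLE on the cover — from `0 < M`, `2 ≤ N₀ < N ≤ k′`, the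
`N₀`-equation, the divisibilities, the separation of record (dag-n11-e's shape) and the two located facts about `Z`.
[cite: Balaban1989LargeFieldI, p.177, (1.10)–(1.12) p.179; Balaban1988Convergent, (2.1)–(2.3) pp.254–255, (2.13) p.256, (3.5) p.265] -/
theorem Zpp_pinStackOfRecord_structure_of_record
    {D : Setting189 (F.P P.K) (SU N) (MSField (F.P P.K) (SU N) × ((j : ℕ) → VecField (F.P P.K) j (EuclideanSpace ℝ (Fin (N ^ 2 - 1))))) (Pt (F.P P.K).d)}
    (hD : D = D189OfHist ν P (sitOfHist ν A₁ M Nm P (σ.pinStackOfRecord ν M g s N₀ Nm) g s N₀ p₁) g)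
    (hM : 0 < M) (hN2 : 2 ≤ N₀) (hN0m : N₀ < Nm) (hNmk : Nm ≤ k')
    (hN₀eq : dCubeSide (F.P P.K).L M (RkOfRecord (F.P P.K).L ν.r (g (k' + 1 - N₀))) (k' + 1 - N₀) = side (F.P P.K).L M k')
    (hdiv : ∀ j, 1 ≤ j → j ≤ k' → dCubeSide (F.P P.K).L M (RkOfRecord (F.P P.K).L ν.r (g j)) j ∣ (F.P P.K).sitesPerDir 0)
    (hdiv0 : side (F.P P.K).L M 0 * RkOfRecord (F.P P.K).L ν.r (g 0) ∣ (F.P P.K).sitesPerDir 0)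
    (hsep : ∀ j, 1 ≤ j → j < k' → hullD (F.P P.K) (sideD F ν M P g j) 3 (s.Ω (j + 1)) ⊆ s.Λ j)
    (hmargin : ∀ j, k' - Nm ≤ j → 1 ≤ j → j ≤ k' - N₀ →
      σ.Z ∩ hullD (F.P P.K) (dCubeSide (F.P P.K).L M (RkOfRecord (F.P P.K).L ν.r (g (j + 1))) (j + 1)) 8 (omegaOfChain s (j + 1)) ⊆ omegaOfChain s j)
    (hZcubes : σ.Z ∈ unionsOfCubes (F.P P.K) (dCubeSide (F.P P.K).L M (RkOfRecord (F.P P.K).L ν.r (g k')) k'))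
    (hZclosed : ∀ a b : Site (F.P P.K) 0, b ∈ σ.Z → a ∉ omegaOfChain s k' →
      a ∈ hullD (F.P P.K) (dCubeSide (F.P P.K).L M (RkOfRecord (F.P P.K).L ν.r (g k')) k') 1 {b} → a ∈ σ.Z) :
    (∀ j, k' - Nm < j → D.Zpp j ⊆ D.Zpp (j + 1)) ∧ (∀ j, k' - Nm < j → j ≤ k' → Disjoint (D.Zpp j) (D.Ω j)) ∧
      σ.Z \ D.Zpp (k' - Nm + 1) ⊆ omegaT F ν M g s (k' - Nm) ∧
      Admissible (F.P P.K).L M k' (pullSeq (B15DeterminingSets.omegaPP (omegaT F ν M g s) (zppOfRecordT F ν M P g s N₀ σ.Z) σ.Z (k' - Nm))) :=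
  Zpp_stack_structure_of_record Nm P σ s N₀ p₁ k' (k' - Nm) _ (enlD F ν M P g) (enlD F ν M P g) (enlD F ν M P g) hD hM hN2 hN0m hNmk hN₀eq hdiv hdiv0 hsep hmargin hZcubes hZclosed

end Structure

/-! ## §4. dag-n12-d's λ-LAYER OVER PRE-PINNED SITUATIONS READS THE NAMED STACK (`rfl`) -/

section Layer

open B15Claim189PinsOfHistory (D189OfHist sitOfHist)

variable {F : T4Family} {N : ℕ} [NeZero N]
variable (lam : ResidW F N) (ν : Stage7Numerics) (A₁ : ℝ) (M : ℕ) (gT : B12.RunParams → ℕ → ℝ) (σT : ∀ P : B12.RunParams, Sit189 F N P.K)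
  (sT : ∀ P : B12.RunParams, SeqOfRecord F ν M (gT P) P.K (lam.kSel P + 1)) (NmT : B12.RunParams → ℕ) (p₁ : ℕ)

/-- **dag-n12-d's `Λ`-PINNED LAYER AT THE PRE-PINNED FAMILY IS THE NAMED STACK OF RECORD** (`rfl`): with `σT P := (σ P).pinPre ν M (g P) (s P) (N₀ P) (N P) enlD`,
`N₀ P := N0OfSeq L r (g P) (kSel P + 1)`, the layer's letters at run `P` are `D189OfHist ν P (sitOfHist ν A₁ M (N P) P ((σ P).pinStackOfRecord ν M (g P) (s P) (N₀ P) (N P)) (g P) (s P) (N₀ P) p₁) (g P)`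
— so §2 and §3 apply to its rows verbatim. [cite: Balaban1989LargeFieldI, (1.89) p.198 (bookkeeping)] -/
theorem pinD189ΛH_pinPre_D189 (P : B12.RunParams) :
    (lam.pinD189ΛH ν A₁ M gT (fun P => (σT P).pinPre ν M (gT P) (sT P) (N0OfSeq (F.P P.K).L ν.r (gT P) (lam.kSel P + 1)) (NmT P) (enlD F ν M P (gT P))) sT NmT p₁).D189 P =
      D189OfHist ν P (sitOfHist ν A₁ M (NmT P) P ((σT P).pinStackOfRecord ν M (gT P) (sT P) (N0OfSeq (F.P P.K).L ν.r (gT P) (lam.kSel P + 1)) (NmT P)) (gT P) (sT P)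
        (N0OfSeq (F.P P.K).L ν.r (gT P) (lam.kSel P + 1)) p₁) (gT P) := rfl

end Layer

end B15Claim189PinStackOfRecord

end Literature.MathematicalPhysics.QuantumFieldTheory.Balaban1983to89
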